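import Summits.KontsevichZagierPeriods.Zeta5Search.WedgeDictionaryLevelDescentVFullLayer0Eval
import HarnessLib

/-!
# Level descent for `U ∧ V` on the unclean cone — §E: the FIRST RUNG of (T3); `levelDescentVFull` (m-form) on the whole first unclean layer (gen-1 g8)

HONEST FRAMING: systematic search; no irrationality claim unless certified.

`WedgeDictionaryLevelDescentVFull` reduces `levelDescentVFull` to ONE row identity (T3) `ldSE_rowSource_stmt` (an `@[conjecture]`
leaf: exact instances only).  Here its first layer is PROVED:

* `ldSE_rowSource_layer0_holds : ldSE_rowSource_layer0_stmt` — (T3) on the layer `c₁₂ = 0` (rows `b₁ + b₂ = N`, `b₇ = 0`).  There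
  everything is explicit: `SE(b) = 0` (clean, `ldSE_eq_zero_of_clean`), `SE(b−e₂)` is the single term `m = −1`
  (`ldSE_layer1`, `ldKer_one`: `Ω̄(b−e₂;−1)·k₅(1)/(N+2)`), `U(b)` is the face value (`coeffU_faceExt_holds` = `ldW_face`).  After the
  `m`-step `Ω(a;−1) ↝ Ω(a;0)` (`ldWeightSym_neg_one`), the two-term relation `ldW_twoTerm` and the factorial evaluations `kernel5_one`,
  `rowEta_fac`, the identity is `(d+1)! = (2N − ΣB + 1)!`, i.e. `d = 2N − ΣB` on this layer; off the face support both sides vanish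
  (`U = 0` and either `Ω̄ = 0` or `Π₂ = 0`).  Exact instances beforehand: 4137/4137 rows, `N ≤ 7` (`HOME/code/gen1/g8/z24_layer0.py`).
* `PVF_layer1_holds : PVF_layer1_stmt` — CONSEQUENCE: the corrected constant row `casUV + SE = ldSum V` (`levelDescentVFull` in `m`-form,
  `PVF`) holds at every shape `b − e₂` of the FIRST UNCLEAN LAYER `c₁₂ = 1` of the rows (below a layer-0 row shape `b` with `Π₂(b) ≠ 0`):
  the face base `ldFaceBaseVF`, the sourced two-term relation (T1) `casUV_rowSource` + the layer-0 (T3) give the homogeneous two-term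
  relation of `casUVE` at `b`, and g7's row step `ldRowStep2_holds` transports the claim to `b − e₂`.  This is the first statement of the
  level-descent programme OFF the clean cone `c₁₂ ≤ b₇`.

* `PVF_graded_holds : PVF_graded_stmt` and `PVF_firstLayer_holds : PVF_firstLayer_stmt` (§E.3) — the GRADED form of the reduction:
  g7's induction consumes (T3) only one layer below, so (T3) on the row layers `c₁₂ ≤ L` gives the corrected constant row on
  `{φ ≤ L + 1}`; with the layer-0 theorem, **`casUV + SE = ldSum V` on the WHOLE first unclean layer `φ(b) ≤ 1` of the region `RW`**
  (`N ≥ 1`, all arrangements of the slots `1, 2, 7`, no `Π₂`-proviso) — superseding the row-only `PVF_layer1_holds`.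

What this is NOT: (T3) in general (the layers `c₁₂ ≥ 1` involve `c₁₂ + 1` boundary terms and the non-closed `U`); anything about
irrationality.  Memo: `HOME/pub-zeta5-gen-1/D2-VFULL-PROOF-g8.md` §8.5.
-/

open Finset Polynomial

namespace Summit.KontsevichZagierPeriods.Zeta5Search.WedgeDictionary

open Summit.KontsevichZagierPeriods.Zeta5Search.DualSeries
open Literature.NumberTheory.Transcendental

/-- On the layer `σ(a) = N − 1` the boundary sum is the single term `m = −1`. -/
theorem ldSE_layer1 (a : ℕ → ℤ) (hN : 1 ≤ a 0) (hσ : sigmaT a + 1 = a 0) : ldSE a = ldEW a (-1) * ldKer a 1 := by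
  unfold ldSE
  rw [sum_eq_single_of_mem (-1 : ℤ) (by simp only [mem_Icc]; omega)]
  · simp [ldE]
  · intro m hm hne
    have : ¬ ldESupp a m := fun hS => by have := hS.2.2; have := (mem_Icc.1 hm).2; omega
    simp [ldE, ldEW, this]

/-- `ldKer a 1 = k₅(1)/(N+2)`. -/
theorem ldKer_one (a : ℕ → ℤ) : ldKer a 1 = kernel5 a 1 / ((a 0 : ℚ) + 2) := by
  unfold ldKer
  simp only [Icc_self, sum_singleton, Nat.sub_self, Nat.factorial_zero, Nat.cast_one, pow_zero, one_mul, mul_one]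
  unfold pochQ
  simp only [range_one, prod_singleton, Nat.cast_zero, add_zero]
  ring

/-- **(T3) on the layer `c₁₂ = 0`** (rows `b₁ + b₂ = N`, `b₇ = 0`): the all-explicit first instance of `ldSE_rowSource_stmt`,
proved by factorial bookkeeping (memo §8.5: after the `m`-step `Ω(a;−1) ↝ Ω(a;0)`, the two-term relation `ldW_twoTerm`, the face value
`ldW_face`/`coeffU_faceExt`, and the evaluations `k₅(1)`, `η(a)`, the identity is `(d+1)! = (2N−ΣB+1)!`, i.e. `d = 2N − ΣB`). -/
theorem ldSE_rowSource_layer0 (b : ℕ → ℤ) (h0 : 0 ≤ b 0) (hbox : ∀ j ∈ Icc 1 7, 0 ≤ b j ∧ b j ≤ b 0)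
    (hB : ∀ j ∈ Icc 3 6, 2 * b j ≤ b 0) (hd : 0 ≤ dOf b) (hb2 : 1 ≤ b 2) (hb7 : b 7 = 0) (hface : b 1 + b 2 = b 0) :
    ((dOf b : ℚ) + 1) * ldSE b - mixedPi2 b * ldSE (lowerSlot b 2) = rowEta (lowerSlot b 2) * coeffU b := by
  have hbox' := hbox; have hB' := hB
  simp only [mem_Icc] at hbox' hB'
  have h1 := hbox' 1 (by omega); have h2 := hbox' 2 (by omega); have h3 := hbox' 3 (by omega); have h4 := hbox' 4 (by omega)
  have h5 := hbox' 5 (by omega); have h6 := hbox' 6 (by omega)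
  have hB3 := hB' 3 (by omega); have hB4 := hB' 4 (by omega); have hB5 := hB' 5 (by omega); have hB6 := hB' 6 (by omega)
  have hdv : dOf b = 2 * b 0 - sumB b := by
    simp only [dOf, sumB, sum_range_succ, sum_range_zero, Nat.reduceAdd, zero_add]; omega
  -- the shape `b` is clean: `SE(b) = 0`
  have hSEb : ldSE b = 0 := ldSE_eq_zero_of_clean b (by unfold sigmaT; omega)
  -- the lowered shape `a = b − e₂`
  have hlow : lowerSlot b 2 = Function.update b 2 (b 2 - 1) := rfl
  rw [hSEb, mul_zero, zero_sub, hlow]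
  set a := Function.update b 2 (b 2 - 1) with ha
  have a0 : a 0 = b 0 := low2_0 b
  have a1 : a 1 = b 1 := low2_1 b
  have a2 : a 2 = b 2 - 1 := low2_2 b
  have a3 : a 3 = b 3 := low2_3 b
  have a4 : a 4 = b 4 := low2_4 b
  have a5 : a 5 = b 5 := low2_5 b
  have a6 : a 6 = b 6 := low2_6 b
  have a7 : a 7 = 0 := (low2_7 b).trans hb7
  have hσa : sigmaT a + 1 = a 0 := by unfold sigmaT; omega
  rw [ldSE_layer1 a (by omega) hσa, ldKer_one a, ha, kernel5_low2 b 1, ← ha, a0]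
  -- the face value of `U`
  have hU := coeffU_faceExt_holds b h0 hbox hd hface
  by_cases hf : faceSupp b
  swap
  · -- off the face support: `U(b) = 0`, and either `Ω̄(a;−1) = 0` or `Π₂(b) = 0`
    rw [hU, if_neg hf, mul_zero]
    by_cases hC : ∀ t ∈ ({1, 2, 7} : Finset ℕ), ∀ j ∈ Icc 3 6, 0 ≤ a 0 - a t - a j
    · have hC' := hC
      simp only [Icc_three_six, mem_insert, mem_singleton, forall_eq_or_imp, forall_eq, a0, a1, a2, a3, a4, a5, a6, a7] at hC'
      have hf' : ¬ ((0 ≤ b 0 - b 2 - b 3) ∧ (0 ≤ b 0 - b 2 - b 4) ∧ (0 ≤ b 0 - b 2 - b 5) ∧ (0 ≤ b 0 - b 2 - b 6)) := by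
        intro h
        apply hf
        simp only [faceSupp, Icc_three_seven, mem_insert, mem_singleton, forall_eq_or_imp, forall_eq]
        omega
      have hb0 : (b 0 : ℚ) = b 1 + b 2 := by exact_mod_cast hface.symm
      have hPi0 : mixedPi2 b = 0 := by
        unfold mixedPi2
        simp only [prod_insert, mem_insert, mem_singleton, prod_singleton, Nat.reduceEqDiff, or_self, not_false_eq_true]
        rcases (by omega : b 3 = b 1 + 1 ∨ b 4 = b 1 + 1 ∨ b 5 = b 1 + 1 ∨ b 6 = b 1 + 1) with h | h | h | h
        · have h' : (b 3 : ℚ) = b 1 + 1 := by exact_mod_cast h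
          rw [hb0, h']; ring
        · have h' : (b 4 : ℚ) = b 1 + 1 := by exact_mod_cast h
          rw [hb0, h']; ring
        · have h' : (b 5 : ℚ) = b 1 + 1 := by exact_mod_cast h
          rw [hb0, h']; ring
        · have h' : (b 6 : ℚ) = b 1 + 1 := by exact_mod_cast h
          rw [hb0, h']; ring
      rw [hPi0]
      ring
    · have hEW : ldEW a (-1) = 0 := by
        have : ¬ ldESupp a (-1) := fun hS => hC hS.1
        simp [ldEW, this]
      rw [hEW]
      ring
  · -- on the face support: `m`-step, two-term relation, face value, kernel and `η` evaluations
    have hfs := hf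
    simp only [faceSupp, Icc_three_seven, mem_insert, mem_singleton, forall_eq_or_imp, forall_eq] at hfs
    have hC : ∀ t ∈ ({1, 2, 7} : Finset ℕ), ∀ j ∈ Icc 3 6, 0 ≤ a 0 - a t - a j := by
      simp only [Icc_three_six, mem_insert, mem_singleton, forall_eq_or_imp, forall_eq, a0, a1, a2, a3, a4, a5, a6, a7]
      omega
    have hC' := hC
    simp only [Icc_three_six, mem_insert, mem_singleton, forall_eq_or_imp, forall_eq, a0, a1, a2, a3, a4, a5, a6, a7] at hC'
    have hES : ldESupp a (-1) := ⟨hC, by norm_num, by omega⟩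
    have hSa : ldSupp a 0 := by
      refine ⟨hC, le_refl _, by omega, by omega, by omega, by omega⟩
    have hSb : ldSupp b (b 7) := by
      rw [hb7]
      refine ⟨?_, le_refl _, by unfold sigmaT; omega, by omega, by omega, by omega⟩
      simp only [Icc_three_six, mem_insert, mem_singleton, forall_eq_or_imp, forall_eq]
      omega
    have hEW : ldEW a (-1) = ldWeightSym a (-1) := by simp [ldEW, hES]
    have hWa : ldW a 0 = ldWeightSym a 0 := by simp [ldW, hSa]
    have hWb : ldW b 0 = coeffU b := by
      rw [ldW_face b 0 h0 hbox hd hface, hU, if_pos hf, if_pos ⟨hb7.symm, hSb⟩]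
    -- two-term relation: `(d+1)·U(b) = Π₂·Ω(a;0)`
    have hTwo := ldW_twoTerm b h0 hbox hB hd hb2 hb7
    rw [hWb, ← ha, hWa] at hTwo
    have hPi : mixedPi2 b = ∏ j ∈ ({1, 3, 4, 5, 6} : Finset ℕ), ((b 0 : ℚ) - b 2 - b j + 1) := rfl
    -- `m`-step
    have hStep := ldWeightSym_neg_one a (by omega) (by omega) (by omega) (by omega) (by omega) (by omega) (by omega)
      (by simp only [sumB]; omega) hσa
    simp only [a0, a1, a2, a3, a4, a5, a6, a7, sumB] at hStep
    -- kernel and `η`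
    have hK := kernel5_one b h0 (fun j hj => by
      simp only [mem_Icc] at hj
      have := hbox' j (by omega); omega)
    have hInA : InBox a := by
      refine ⟨by omega, fun j hj => ?_⟩
      simp only [mem_range] at hj
      interval_cases j <;> simp only [Nat.reduceAdd, a1, a2, a3, a4, a5, a6, a7, a0] <;> omega
    have hEta := rowEta_fac a hInA (fun j hj => by
      simp only [mem_range] at hj
      interval_cases j <;> simp only [Nat.reduceAdd, a1, a2, a3, a4, a5, a6, a7, a0] <;> omega)
    simp only [prod_range_succ, prod_range_zero, one_mul, Nat.reduceAdd, a0, a1, a2, a3, a4, a5, a6, a7, sub_zero,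
      Icc_three_six, prod_insert, mem_insert, mem_singleton, prod_singleton, Nat.reduceEqDiff, or_self,
      not_false_eq_true] at hEta hK
    -- factorial relations between the atoms
    have hf1 : facQ (b 0 - b 1) = facQ (b 2) := by rw [show b 0 - b 1 = b 2 by omega]
    have hf2 : facQ (b 0 - (b 2 - 1)) = ((b 1 : ℚ) + 1) * facQ (b 1) := by
      rw [show b 0 - (b 2 - 1) = b 1 + 1 by omega, facQ_succ h1.1]
    have hf3 : facQ (b 2) = (b 2 : ℚ) * facQ (b 2 - 1) := by
      have := facQ_succ (z := b 2 - 1) (by omega)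
      rw [sub_add_cancel] at this
      push_cast at this
      linear_combination this
    have hg3 : facQ (b 0 + 1 - b 3) = ((b 0 : ℚ) - b 3 + 1) * facQ (b 0 - b 3) := by
      rw [show b 0 + 1 - b 3 = b 0 - b 3 + 1 by ring, facQ_succ (by omega)]; push_cast; ring
    have hg4 : facQ (b 0 + 1 - b 4) = ((b 0 : ℚ) - b 4 + 1) * facQ (b 0 - b 4) := by
      rw [show b 0 + 1 - b 4 = b 0 - b 4 + 1 by ring, facQ_succ (by omega)]; push_cast; ring
    have hg5 : facQ (b 0 + 1 - b 5) = ((b 0 : ℚ) - b 5 + 1) * facQ (b 0 - b 5) := by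
      rw [show b 0 + 1 - b 5 = b 0 - b 5 + 1 by ring, facQ_succ (by omega)]; push_cast; ring
    have hg6 : facQ (b 0 + 1 - b 6) = ((b 0 : ℚ) - b 6 + 1) * facQ (b 0 - b 6) := by
      rw [show b 0 + 1 - b 6 = b 0 - b 6 + 1 by ring, facQ_succ (by omega)]; push_cast; ring
    rw [hf1, hf2, facQ_zero] at hEta
    rw [hg3, hg4, hg5, hg6] at hK
    have hdq : (dOf b : ℚ) = 2 * (b 0 : ℚ) - (b 3 + b 4 + b 5 + b 6 : ℚ) := by
      rw [hdv]; simp only [sumB]; push_cast; ring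
    -- nonzero atoms
    have nz2 : facQ (b 2) ≠ 0 := facQ_ne_zero _
    have nz21 : facQ (b 2 - 1) ≠ 0 := facQ_ne_zero _
    have nz1 : facQ (b 1) ≠ 0 := facQ_ne_zero _
    have nz0 : facQ (b 0) ≠ 0 := facQ_ne_zero _
    have ng3 : facQ (b 0 - b 3) ≠ 0 := facQ_ne_zero _
    have ng4 : facQ (b 0 - b 4) ≠ 0 := facQ_ne_zero _
    have ng5 : facQ (b 0 - b 5) ≠ 0 := facQ_ne_zero _
    have ng6 : facQ (b 0 - b 6) ≠ 0 := facQ_ne_zero _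
    have hb1q : (0 : ℚ) ≤ b 1 := by exact_mod_cast h1.1
    have hb2q : (1 : ℚ) ≤ b 2 := by exact_mod_cast hb2
    have hb3q : (b 3 : ℚ) ≤ b 0 := by exact_mod_cast h3.2
    have hb4q : (b 4 : ℚ) ≤ b 0 := by exact_mod_cast h4.2
    have hb5q : (b 5 : ℚ) ≤ b 0 := by exact_mod_cast h5.2
    have hb6q : (b 6 : ℚ) ≤ b 0 := by exact_mod_cast h6.2
    have hb0q : (0 : ℚ) ≤ b 0 := by exact_mod_cast h0
    have hdq0 : (0 : ℚ) ≤ dOf b := by exact_mod_cast hd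
    have p3 : (b 0 : ℚ) - b 3 + 1 ≠ 0 := ne_of_gt (by linarith)
    have p4 : (b 0 : ℚ) - b 4 + 1 ≠ 0 := ne_of_gt (by linarith)
    have p5 : (b 0 : ℚ) - b 5 + 1 ≠ 0 := ne_of_gt (by linarith)
    have p6 : (b 0 : ℚ) - b 6 + 1 ≠ 0 := ne_of_gt (by linarith)
    have q1 : (b 1 : ℚ) + 1 ≠ 0 := ne_of_gt (by linarith)
    have q2 : (b 2 : ℚ) ≠ 0 := ne_of_gt (by linarith)
    have qd : (dOf b : ℚ) + 1 ≠ 0 := ne_of_gt (by linarith)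
    have qN : (b 0 : ℚ) + 2 ≠ 0 := ne_of_gt (by linarith)
    -- solve the four evaluations for the atoms
    have hW1 : ldWeightSym a (-1) =
        -(ldWeightSym a 0 * (((b 0 : ℚ) - b 3 + 1) * ((b 0 : ℚ) - b 4 + 1) * ((b 0 : ℚ) - b 5 + 1) * ((b 0 : ℚ) - b 6 + 1))) /
          (((b 1 : ℚ) + 1) * (b 2 : ℚ) * ((dOf b : ℚ) + 1)) := by
      rw [eq_div_iff (mul_ne_zero (mul_ne_zero q1 q2) qd), hdq]
      push_cast at hStep
      linear_combination hStep
    have hk : kernel5 b 1 = ((b 0 : ℚ) + 2) * (facQ (b 3) * (facQ (b 4) * (facQ (b 5) * facQ (b 6)))) /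
        (((b 0 : ℚ) - b 3 + 1) * facQ (b 0 - b 3) * (((b 0 : ℚ) - b 4 + 1) * facQ (b 0 - b 4) *
          (((b 0 : ℚ) - b 5 + 1) * facQ (b 0 - b 5) * (((b 0 : ℚ) - b 6 + 1) * facQ (b 0 - b 6))))) := by
      rw [eq_div_iff (by
        refine mul_ne_zero (mul_ne_zero p3 ng3) (mul_ne_zero (mul_ne_zero p4 ng4) (mul_ne_zero (mul_ne_zero p5 ng5) (mul_ne_zero p6 ng6))))]
      exact hK
    rw [hf3] at hEta
    have hη : rowEta a = facQ (b 1) * facQ (b 2 - 1) * facQ (b 3) * facQ (b 4) * facQ (b 5) * facQ (b 6) * 1 * facQ (b 0) /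
        ((b 2 : ℚ) * facQ (b 2 - 1) * (((b 1 : ℚ) + 1) * facQ (b 1)) * facQ (b 0 - b 3) * facQ (b 0 - b 4) * facQ (b 0 - b 5) *
          facQ (b 0 - b 6) * facQ (b 0)) := by
      rw [eq_div_iff (by
        refine mul_ne_zero (mul_ne_zero (mul_ne_zero (mul_ne_zero (mul_ne_zero (mul_ne_zero (mul_ne_zero q2 nz21) (mul_ne_zero q1 nz1)) ng3) ng4) ng5) ng6) nz0)]
      exact hEta
    have hcU : coeffU b = mixedPi2 b * ldWeightSym a 0 / ((dOf b : ℚ) + 1) := by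
      rw [eq_div_iff qd, hPi]
      linear_combination hTwo
    rw [hEW, hW1, hk, hη, hcU]
    field_simp

/-- STATEMENT (§E, PROVED as `ldSE_rowSource_layer0_holds`): the row identity (T3) `ldSE_rowSource_stmt` on the layer `c₁₂ = 0` (`b₁ + b₂ = N`). -/
def ldSE_rowSource_layer0_stmt : Prop :=
  ∀ b : ℕ → ℤ, 0 ≤ b 0 → (∀ j ∈ Icc 1 7, 0 ≤ b j ∧ b j ≤ b 0) → (∀ j ∈ Icc 3 6, 2 * b j ≤ b 0) → 0 ≤ dOf b →
    1 ≤ b 2 → b 7 = 0 → b 1 + b 2 = b 0 →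
    ((dOf b : ℚ) + 1) * ldSE b - mixedPi2 b * ldSE (lowerSlot b 2) = rowEta (lowerSlot b 2) * coeffU b

/-- (T3) on the layer `c₁₂ = 0` holds: `ldSE_rowSource_layer0_stmt` (by-name wrapper). -/
theorem ldSE_rowSource_layer0_holds : ldSE_rowSource_layer0_stmt := fun b h0 hbox hB hd hb2 hb7 hface =>
  ldSE_rowSource_layer0 b h0 hbox hB hd hb2 hb7 hface

/-- STATEMENT (§E, PROVED as `PVF_layer1_holds`): the corrected constant-row claim `casUV + SE = ldSum V` (`levelDescentVFull` in `m`-form)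
at the shapes `b − e₂` of the first unclean layer `c₁₂ = 1` (rows `b₇ = 0`, `b₁ + b₂ = N`, `Π₂(b) ≠ 0`). -/
def PVF_layer1_stmt : Prop :=
  ∀ b : ℕ → ℤ, 0 ≤ b 0 → (∀ j ∈ Icc 1 7, 0 ≤ b j ∧ b j ≤ b 0) → (∀ j ∈ Icc 3 6, 2 * b j ≤ b 0) → 0 ≤ dOf b →
    1 ≤ b 2 → b 7 = 0 → b 1 + b 2 = b 0 → mixedPi2 b ≠ 0 → PVF (lowerSlot b 2)

/-- The corrected constant row on the first unclean layer below a layer-0 row with `Π₂ ≠ 0`: `PVF_layer1_stmt` holds (by-name wrapper). -/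
theorem PVF_layer1_holds : PVF_layer1_stmt := by
  intro b h0 hbox hB hd hb2 hb7 hface hPi
  have hIn : InBox b := ⟨h0, fun j hj => by
    have := hbox (j + 1) (by simp only [mem_range] at hj; simp only [mem_Icc]; omega); omega⟩
  have hN1 : 1 ≤ b 0 := by have := (hbox 2 (by simp)).2; omega
  have hP : PVF b := ldFaceBaseVF coeffU_faceExt_holds b hN1 hbox hd hface
  have h1 := casUV_rowSource b hIn hb7 hd hb2 (hbox 2 (by simp)).2
  have h3 := ldSE_rowSource_layer0 b h0 hbox hB hd hb2 hb7 hface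
  have htt : ((dOf b : ℚ) + 1) * casUVE b = mixedPi2 b * casUVE (lowerSlot b 2) := by
    unfold casUVE
    linear_combination h1 + h3
  exact ldRowStep2_holds coeffV casUVE b h0 hbox hB hd hb2 hb7 hPi htt hP


/-! ### §E.3  The graded reduction `(T3) on layers ≤ L ⟹ PVF on φ ≤ L + 1`, and `PVF` on the WHOLE first unclean layer

g7's induction (`stepVF_sorted` / `ldInductionVF` of `WedgeDictionaryLevelDescentVFull`) consumes (T3) only at the sorted row shape
`b + e₂`, whose layer is `c₁₂(b + e₂) = φ(b) − 1`.  Hence (T3) on the layers `c₁₂ ≤ L` already gives the corrected constant row on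
`{φ ≤ L + 1}`; with §E.2 (`L = 0`) this is `PVF` on the whole first unclean layer `φ(b) ≤ 1` of the region `RW` — every arrangement of
the slots `1, 2, 7`, no `Π₂`-proviso. -/

/-- (T3) restricted to the rows of the layers `c₁₂ = N − b₁ − b₂ ≤ L`. -/
def ldSE_rowSource_upto (L : ℤ) : Prop :=
  ∀ b : ℕ → ℤ, 0 ≤ b 0 → (∀ j ∈ Icc 1 7, 0 ≤ b j ∧ b j ≤ b 0) → (∀ j ∈ Icc 3 6, 2 * b j ≤ b 0) → 0 ≤ dOf b →
    1 ≤ b 2 → b 7 = 0 → b 1 + b 2 ≤ b 0 → b 0 ≤ b 1 + b 2 + L →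
    ((dOf b : ℚ) + 1) * ldSE b - mixedPi2 b * ldSE (lowerSlot b 2) = rowEta (lowerSlot b 2) * coeffU b

/-- The graded hypothesis family at level `0` is the layer-0 theorem. -/
theorem ldSE_rowSource_upto_zero : ldSE_rowSource_upto 0 := fun b h0 hbox hB hd hb2 hb7 hle hge =>
  ldSE_rowSource_layer0 b h0 hbox hB hd hb2 hb7 (by omega)

/-- Pointwise form of `casUVE_twoTerm`: (T1) + (T3) at one row shape. -/
theorem casUVE_twoTerm_at (b : ℕ → ℤ) (hb : InBox b) (hd : 0 ≤ dOf b) (hb2 : 1 ≤ b 2) (hb7 : b 7 = 0) (h2N : b 2 ≤ b 0)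
    (h3 : ((dOf b : ℚ) + 1) * ldSE b - mixedPi2 b * ldSE (lowerSlot b 2) = rowEta (lowerSlot b 2) * coeffU b) :
    ((dOf b : ℚ) + 1) * casUVE b = mixedPi2 b * casUVE (lowerSlot b 2) := by
  have h1 := casUV_rowSource b hb hb7 hd hb2 h2N
  unfold casUVE
  linear_combination h1 + h3

/-- The graded step (cf. `stepVF_sorted`): at a sorted shape with `φ(b) ≤ n + 1 ≤ L + 1`, (T3) is needed only on the layer `n ≤ L`. -/
theorem stepVF_sorted_upto (L : ℤ) (hT : ldSE_rowSource_upto L) {n : ℕ} (hnL : (n : ℤ) ≤ L)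
    (IH : ∀ b' : ℕ → ℤ, RW b' → 1 ≤ b' 0 → phi b' ≤ n → PVF b')
    (b : ℕ → ℤ) (hR : RW b) (hN1 : 1 ≤ b 0) (hphi : phi b ≤ n + 1) (h72 : b 7 ≤ b 2) (h21 : b 2 ≤ b 1) :
    PVF b := by
  have hS := slots_of_RW b hR
  have hd : 0 ≤ dOf b := hR.2.2.2.1
  by_cases hface : b 1 + b 2 = b 0
  · exact ldFaceBaseVF coeffU_faceExt_holds b hN1 hS hd hface
  have hlt : b 1 + b 2 + 1 ≤ b 0 := by have := hR.2.2.2.2.1; omega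
  obtain ⟨bp0, bp1, bp2, bp7, dbp, -, hlow, hRbp, hBbp, hPi2, hd1⟩ := bplus_facts b hR hN1 h72 h21 hlt
  set bp := Function.update b 2 (b 2 + 1) with hbp
  have hSbp := slots_of_RW bp hRbp
  have hdbp : 0 ≤ dOf bp := by rw [dbp]; omega
  have h2bp : 1 ≤ bp 2 := by rw [bp2]; have := (hS 2 (by simp)).1; omega
  have h0bp : 0 ≤ bp 0 := by rw [bp0]; omega
  have hphibp : phi bp ≤ n := by unfold phi at hphi ⊢; rw [bp0, bp1, bp2, bp7]; omega
  have hPbp : PVF bp := IH bp hRbp (by rw [bp0]; exact hN1) hphibp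
  by_cases h70 : b 7 = 0
  · -- two-term branch (rows): (T3) is used at `bp`, a row of the layer `c₁₂(bp) = φ(b) − 1 ≤ n ≤ L`
    have h7bp : bp 7 = 0 := by rw [bp7]; exact h70
    have hlay : bp 0 ≤ bp 1 + bp 2 + L := by
      unfold phi at hphi; rw [bp0, bp1, bp2]; omega
    have h3 := hT bp h0bp hSbp hBbp hdbp h2bp h7bp (by rw [bp1, bp2, bp0]; omega) hlay
    have htt := casUVE_twoTerm_at bp (inBox_of_RW bp hRbp) hdbp h2bp h7bp (hSbp 2 (by simp)).2 h3
    have key := ldRowStep2_holds coeffV casUVE bp h0bp hSbp hBbp hdbp h2bp h7bp hPi2 htt hPbp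
    unfold PVF
    rwa [hlow] at key
  · -- three-term branch: no (T3) needed
    have h71 : 1 ≤ b 7 := by have := (hS 7 (by simp)).1; omega
    obtain ⟨bm0, hRbm, hphibm, -⟩ := bminus_facts b hR hN1 h72 h21 hlt h71
    have hPbm : PVF (lowerSlot bp 7) := IH _ hRbm (by rw [bm0]; exact hN1) (by rw [hbp]; omega)
    have h7bp : 1 ≤ bp 7 := by rw [bp7]; exact h71
    have hMix : MixedHyp bp :=
      ⟨inBox_of_RW bp hRbp, hdbp, h2bp, h7bp, by rw [bp2, bp7, bp0]; omega, fun j hj => (hSbp j hj).2⟩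
    have hX := casUVE_crossRel bp hMix hSbp hBbp
    have hPi : (bp 2 : ℚ) * mixedPi2 bp ≠ 0 :=
      mul_ne_zero (by exact_mod_cast (show bp 2 ≠ 0 by omega)) hPi2
    have key := ldStep27_holds coeffV casUVE bp h0bp hSbp hBbp hdbp h2bp h7bp hPi hX hPbp hPbm
    unfold PVF
    rwa [hlow] at key

/-- The graded induction: (T3) on the layers `≤ L` gives the corrected constant row on `{φ ≤ n}` for every `n ≤ L + 1`. -/
theorem ldInductionVF_upto (L : ℤ) (hT : ldSE_rowSource_upto L) :
    ∀ (n : ℕ), (n : ℤ) ≤ L + 1 → ∀ (b : ℕ → ℤ), RW b → 1 ≤ b 0 → phi b ≤ n → PVF b := by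
  intro n
  induction n with
  | zero =>
    intro _ b hR hN1 hphi
    refine sorted_reduction (fun b => RW b → 1 ≤ b 0 → phi b ≤ ((0 : ℕ) : ℤ) → PVF b)
      (fun b j k hj hk hQ => QVF_transport _ b j k hj hk hQ) ?_ b hR hN1 hphi
    intro b h72 h21 hR hN1 hphi
    have hface : b 1 + b 2 = b 0 := by have := hR.2.2.2.2.1; unfold phi at hphi; push_cast at hphi; omega
    exact ldFaceBaseVF coeffU_faceExt_holds b hN1 (slots_of_RW b hR) hR.2.2.2.1 hface
  | succ n ih =>
    intro hn b hR hN1 hphi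
    have hnL : (n : ℤ) ≤ L := by push_cast at hn; omega
    refine sorted_reduction (fun b => RW b → 1 ≤ b 0 → phi b ≤ ((n + 1 : ℕ) : ℤ) → PVF b)
      (fun b j k hj hk hQ => QVF_transport _ b j k hj hk hQ) ?_ b hR hN1 hphi
    intro b h72 h21 hR hN1 hphi
    push_cast at hphi
    exact stepVF_sorted_upto L hT hnL (ih (by omega)) b hR hN1 hphi h72 h21

/-- STATEMENT (PROVED as `PVF_graded_holds`): **graded reduction** — (T3) on the row layers `c₁₂ ≤ L` (`L ≥ 0`) implies the corrected
constant row `casUV + SE = ldSum V` on the part `φ(b) ≤ L + 1` of the region `RW` (`N ≥ 1`). -/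
def PVF_graded_stmt : Prop :=
  ∀ L : ℤ, 0 ≤ L → ldSE_rowSource_upto L → ∀ b : ℕ → ℤ, RW b → 1 ≤ b 0 → phi b ≤ L + 1 → PVF b

/-- The graded reduction `PVF_graded_stmt` holds (by-name wrapper). -/
theorem PVF_graded_holds : PVF_graded_stmt := by
  intro L hL hT b hR hN1 hphi
  have h1 : ((L + 1).toNat : ℤ) = L + 1 := Int.toNat_of_nonneg (by omega)
  exact ldInductionVF_upto L hT (L + 1).toNat (by omega) b hR hN1 (by omega)

/-- STATEMENT (PROVED as `PVF_firstLayer_holds`): **the corrected constant row `casUV + SE = ldSum V` (`levelDescentVFull` in `m`-form)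
holds on the WHOLE FIRST UNCLEAN LAYER** `φ(b) ≤ 1` of the region `RW` (`N ≥ 1`; all arrangements of the slots `1, 2, 7`). -/
def PVF_firstLayer_stmt : Prop := ∀ b : ℕ → ℤ, RW b → 1 ≤ b 0 → phi b ≤ 1 → PVF b

/-- `PVF_firstLayer_stmt` holds: the corrected constant row on the whole first unclean layer (by-name wrapper). -/
theorem PVF_firstLayer_holds : PVF_firstLayer_stmt := fun b hR hN1 hphi =>
  PVF_graded_holds 0 le_rfl ldSE_rowSource_upto_zero b hR hN1 (by simpa using hphi)

end Summit.KontsevichZagierPeriods.Zeta5Search.WedgeDictionary
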